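import Literature.Barriers.QuantumFields.FreeTwoPointBoundaryValueProofs
import Literature.Barriers.QuantumFields.FreeTwoPointEuclideanProofs
import Literature.Barriers.QuantumFields.FreeTwoPointHolomorphyProofs
import Literature.MathematicalPhysics.QuantumLattice.FreeFieldMomentsProofs
import Literature.MathematicalPhysics.QuantumFieldTheory.Wightman
import HarnessLib

/-!
# The two-point function of the free hermitian scalar field: proof of `FreeFieldTwoPointFn`

Sibling proof file of `JostSchroerSteps.lean` (theorems only). It discharges the named fact
`FreeFieldTwoPointFn`: for a free hermitian scalar field of mass `m > 0` in the tree's sense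
(`IsFreeHermitianScalarField d m W`: a Wightman QFT whose Wightman distributions are the Wick
rotation of the Schwinger functions of the Gaussian measure of covariance `(−Δ + m²)⁻¹`), the
smeared two-point Wightman function is `freeTwoPoint d m` (Glimm–Jaffe §6.2: "Then `W₂ = Δ⁺ₘ`").

The argument (Osterwalder–Schrader, for `n = 2` and the free field):

* the Schwinger two-point function of the Gaussian measure on real tensors is `C_m`
  (`IsFreeField.moment_two`), which is real on real test functions
  (`freeCovariance_ofRealTest_im`);
* by the Wick rotation hypothesis, `∫ 𝔚(ιx) F = 𝔖₂(F)` on time-ordered `F`, with `𝔚` the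
  holomorphic two-point function of `W` on the forward tube; the explicit free holomorphic
  two-point function `𝔚_free` (`FreeTwoPointContinuation`) has the same smeared Euclidean values
  on gapped real tensors (`integral_freeTwoPointWightmanHol_euclideanPoint_eq`); a positivity
  argument with bump tensors (`eq_zero_of_integral_bump_tensor`) upgrades this to
  `𝔚 ∘ ι = 𝔚_free ∘ ι` pointwise on the time-ordered region, and the Euclidean uniqueness of the
  tree (`eqOn_forwardTube_of_euclidean`) to `𝔚 = 𝔚_free` on the forward tube;
* hence the boundary values agree: the Wightman two-point distribution of `W` on `F ⊗ G` is the
  ray limit of `𝔚_free`, i.e. `freeTwoPoint d m F G`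
  (`tendsto_integral_freeTwoPointWightmanHol_tensor`).

## References

* J. Glimm, A. Jaffe, *Quantum Physics* (2nd ed. 1987), §6.1 (6.1.17), Thm 6.1.5; §6.2
  (6.2.6)–(6.2.10), Thm 6.2.4 and the Definition of the free field (pdf pp. 92, 95–96).
  [GlimmJaffeQP1987]
* K. Osterwalder, R. Schrader, Comm. Math. Phys. 31 (1973), §4 (4.12)–(4.14).
  [OsterwalderSchraderCMP1973]
* R. F. Streater, A. S. Wightman, *PCT, Spin and Statistics, and All That*, §3-2 (pdf p. 102).
  [StreaterWightman2001]
-/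

noncomputable section

open MeasureTheory Complex Real Filter Topology
open scoped InnerProductSpace SchwartzMap ComplexConjugate FourierTransform

namespace Literature.Barriers.QuantumFields

open Literature.MathematicalPhysics Literature.MathematicalPhysics.QuantumLattice

variable {d : ℕ}

/-! ### The free covariance is real on real test functions -/

/-- For a real-valued function, `𝓕 f (−ξ) = conj (𝓕 f ξ)`. [folklore] -/
theorem fourier_neg_eq_conj_of_real {V : Type*} [NormedAddCommGroup V] [InnerProductSpace ℝ V]
    [FiniteDimensional ℝ V] [MeasurableSpace V] [BorelSpace V] {f : V → ℂ}
    (hf : ∀ x, conj (f x) = f x) (ξ : V) : 𝓕 f (-ξ) = conj (𝓕 f ξ) := by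
  rw [Real.fourier_eq, Real.fourier_eq, ← integral_conj]
  refine integral_congr_ae (Eventually.of_forall fun x => ?_)
  simp only [Circle.smul_def, smul_eq_mul, map_mul, hf, Circle.starRingEnd_addChar,
    inner_neg_right, neg_neg]

/-- The free symbol is even. [folklore] -/
theorem freeSymbol_neg_arg {V : Type*} [NormedAddCommGroup V] [InnerProductSpace ℝ V] (m : ℝ)
    (ξ : V) : freeSymbol m (-ξ) = freeSymbol m ξ := by
  rw [freeSymbol_apply, freeSymbol_apply, norm_neg]

/-- **The free covariance of two real test functions is real**:
`Im C_m(f, g) = 0` for `f = f̄`, `g = ḡ` (reflect `ξ ↦ −ξ` in the momentum integral and use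
`𝓕 f(−ξ) = conj 𝓕 f(ξ)`). [folklore] -/
theorem freeCovariance_im_eq_zero_of_real (m : ℝ) {f g : 𝓢(EuclideanSpace ℝ (Fin (d + 1)), ℂ)}
    (hf : ∀ x, conj (f x) = f x) (hg : ∀ x, conj (g x) = g x) :
    (freeCovariance m f g).im = 0 := by
  have hconj : conj (freeCovariance m f g) = freeCovariance m f g := by
    unfold freeCovariance
    rw [← integral_conj, ← integral_neg_eq_self]
    refine integral_congr_ae (Eventually.of_forall fun ξ => ?_)
    simp only [map_mul, Complex.conj_conj, Complex.conj_ofReal, SchwartzMap.fourier_coe,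
      fourier_neg_eq_conj_of_real hf, fourier_neg_eq_conj_of_real hg, Complex.conj_conj,
      freeSymbol_neg_arg]
  exact Complex.conj_eq_iff_im.1 hconj

/-- `Im C_m(f, g) = 0` for complexified real test functions. [folklore] -/
theorem freeCovariance_ofRealTest_im (m : ℝ) (f g : 𝓢(EuclideanSpace ℝ (Fin (d + 1)), ℝ)) :
    (freeCovariance m (ofRealTest f) (ofRealTest g)).im = 0 :=
  freeCovariance_im_eq_zero_of_real m (fun x => by simp [ofRealTest_apply])
    (fun x => by simp [ofRealTest_apply])

/-! ### From vanishing against bump tensors to pointwise vanishing -/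

/-- **A continuous function integrating to zero against all small bump tensors at a point
vanishes there.** If `D` is continuous on an open `U ∋ y` and `∫ D(x) b₀(x₀) b₁(x₁) dx = 0`
for all normalised bump functions `b₀`, `b₁` centred at `y₀`, `y₁` of equal, sufficiently small
outer radius, then `D y = 0` (else `Re (c̄ D) > ‖c‖²/2` near `y`, `c = D y`, and the integral
against non-negative bumps of unit mass concentrated there has real part `≥ ‖c‖²/2`).
[folklore] -/
theorem eq_zero_of_integral_bump_tensor {E : Type*} [NormedAddCommGroup E] [InnerProductSpace ℝ E]
    [FiniteDimensional ℝ E] [MeasurableSpace E] [BorelSpace E]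
    {D : (Fin 2 → E) → ℂ} {U : Set (Fin 2 → E)} (hU : IsOpen U) (hD : ContinuousOn D U)
    {y : Fin 2 → E} (hy : y ∈ U) {r₀ : ℝ} (hr₀ : 0 < r₀)
    (h : ∀ (b₀ : ContDiffBump (y 0)) (b₁ : ContDiffBump (y 1)), b₀.rOut < r₀ →
      b₁.rOut = b₀.rOut →
        ∫ x : Fin 2 → E, D x * ((b₀.normed volume (x 0) : ℂ) * (b₁.normed volume (x 1) : ℂ)) = 0) :
    D y = 0 := by
  by_contra hc
  set c : ℂ := D y with hcdef
  have hcn : 0 < ‖c‖ := norm_pos_iff.2 hc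
  -- a ball around `y` inside `U` where `D ≈ c`
  have hO : IsOpen (U ∩ D ⁻¹' Metric.ball c (‖c‖ / 2)) :=
    hD.isOpen_inter_preimage hU Metric.isOpen_ball
  obtain ⟨ρ, hρ, hball⟩ := Metric.isOpen_iff.1 hO y ⟨hy, by simpa [hcdef] using half_pos hcn⟩
  -- the bumps
  set r : ℝ := min (ρ / 2) (r₀ / 2) with hr
  have hr0 : 0 < r := lt_min (half_pos hρ) (half_pos hr₀)
  have hrρ : r < ρ := (min_le_left _ _).trans_lt (half_lt_self hρ)
  have hrr₀ : r < r₀ := (min_le_right _ _).trans_lt (half_lt_self hr₀)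
  set b₀ : ContDiffBump (y 0) := ⟨r / 2, r, half_pos hr0, half_lt_self hr0⟩ with hb₀
  set b₁ : ContDiffBump (y 1) := ⟨r / 2, r, half_pos hr0, half_lt_self hr0⟩ with hb₁
  have key := h b₀ b₁ hrr₀ rfl
  set P : (Fin 2 → E) → ℝ := fun x => b₀.normed volume (x 0) * b₁.normed volume (x 1) with hP
  have hP0 : ∀ x, 0 ≤ P x := fun x => mul_nonneg (b₀.nonneg_normed _) (b₁.nonneg_normed _)
  have hPc : Continuous P :=
    (b₀.continuous_normed.comp (continuous_apply 0)).mul (b₁.continuous_normed.comp (continuous_apply 1))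
  -- support of `P` lies in the ball of radius `ρ` around `y`
  have hPsupp : ∀ x, P x ≠ 0 → dist x y ≤ r := by
    intro x hx
    rw [dist_pi_le_iff hr0.le]
    intro j
    fin_cases j
    · have h0 : b₀.normed volume (x 0) ≠ 0 := left_ne_zero_of_mul hx
      have := subset_tsupport _ (Function.mem_support.2 h0)
      rwa [b₀.tsupport_normed_eq, Metric.mem_closedBall] at this
    · have h1 : b₁.normed volume (x 1) ≠ 0 := right_ne_zero_of_mul hx
      have := subset_tsupport _ (Function.mem_support.2 h1)
      rwa [b₁.tsupport_normed_eq, Metric.mem_closedBall] at this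
  have htsupp : tsupport (fun x => (P x : ℂ)) ⊆ U ∩ D ⁻¹' Metric.ball c (‖c‖ / 2) := by
    intro x hx
    have h1 : tsupport (fun x => (P x : ℂ)) ⊆ Metric.closedBall y r := by
      refine closure_minimal (fun x hx => Metric.mem_closedBall.2 (hPsupp x ?_)) Metric.isClosed_closedBall
      exact fun h0 => hx (by simp [h0])
    exact hball (Metric.mem_ball.2 (lt_of_le_of_lt (Metric.mem_closedBall.1 (h1 hx)) hrρ))
  have hPcpt : HasCompactSupport fun x => (P x : ℂ) := by
    refine HasCompactSupport.intro (K := Metric.closedBall y r) (isCompact_closedBall _ _) ?_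
    intro x hx
    have : P x = 0 := by
      by_contra h0
      exact hx (Metric.mem_closedBall.2 (hPsupp x h0))
    simp [this]
  -- integrability
  have hI : ∀ {H : (Fin 2 → E) → ℂ}, ContinuousOn H U → Integrable fun x => H x * (P x : ℂ) := by
    intro H hH
    refine Continuous.integrable_of_hasCompactSupport ?_ hPcpt.mul_left
    exact QuantumFieldTheory.continuous_mul_of_tsupport_subset hU hH
      (Complex.continuous_ofReal.comp hPc) fun x hx => (htsupp hx).1
  have hDI : Integrable fun x => D x * (P x : ℂ) := hI hD
  -- total mass one
  have hPone : ∫ x : Fin 2 → E, (P x : ℂ) = 1 := by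
    have hprod := integral_fintype_prod_volume_eq_prod (ι := Fin 2) (E := fun _ => E)
      (fun i => ((![fun v => (b₀.normed volume v : ℂ), fun v => (b₁.normed volume v : ℂ)] :
        Fin 2 → E → ℂ)) i)
    simp only [Fin.prod_univ_two, Matrix.cons_val_zero, Matrix.cons_val_one] at hprod
    have e : ∀ x : Fin 2 → E, (P x : ℂ) = (b₀.normed volume (x 0) : ℂ) * (b₁.normed volume (x 1) : ℂ) :=
      fun x => by simp [hP]
    simp_rw [e]
    rw [hprod, integral_complex_ofReal, integral_complex_ofReal, b₀.integral_normed, b₁.integral_normed]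
    simp
  -- the lower bound `‖c‖²/2 ≤ Re (c̄ ∫ D P)`
  have hkey0 : ∫ x : Fin 2 → E, D x * (P x : ℂ) = 0 := by
    rw [← key]
    refine integral_congr_ae (Eventually.of_forall fun x => ?_)
    simp [hP]
  have hineq : ‖c‖ ^ 2 / 2 ≤ (conj c * ∫ x : Fin 2 → E, D x * (P x : ℂ)).re := by
    have hID : Integrable fun x => conj c * (D x * (P x : ℂ)) := hDI.const_mul _
    rw [← integral_const_mul, ← RCLike.re_to_complex, ← integral_re hID]
    have hlow : ∫ x : Fin 2 → E, ‖c‖ ^ 2 / 2 * P x = ‖c‖ ^ 2 / 2 := by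
      rw [integral_const_mul]
      have : ∫ x : Fin 2 → E, P x = (∫ x : Fin 2 → E, (P x : ℂ)).re := by
        rw [integral_complex_ofReal, Complex.ofReal_re]
      rw [this, hPone, Complex.one_re, mul_one]
    rw [← hlow]
    have hPcptR : HasCompactSupport P := by
      refine HasCompactSupport.intro (K := Metric.closedBall y r) (isCompact_closedBall _ _) ?_
      intro x hx
      by_contra h0
      exact hx (Metric.mem_closedBall.2 (hPsupp x h0))
    refine integral_mono ((hPc.integrable_of_hasCompactSupport hPcptR).const_mul _) hID.re
      fun x => ?_
    show ‖c‖ ^ 2 / 2 * P x ≤ RCLike.re (conj c * (D x * (P x : ℂ)))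
    rw [RCLike.re_to_complex]
    by_cases hx : P x = 0
    · rw [hx]; simp
    · have hxO := htsupp (subset_tsupport _ (by simpa using hx : (fun x => (P x : ℂ)) x ≠ 0))
      have hb : ‖D x - c‖ < ‖c‖ / 2 := by
        have := hxO.2
        rwa [Set.mem_preimage, Metric.mem_ball, dist_eq_norm] at this
      have h1 := half_norm_sq_le_re_conj_mul hb
      rw [show conj c * (D x * (P x : ℂ)) = (conj c * D x) * (P x : ℂ) by ring,
        Complex.re_mul_ofReal]
      exact mul_le_mul_of_nonneg_right h1 (hP0 x)
  rw [hkey0, mul_zero, Complex.zero_re] at hineq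
  nlinarith

/-! ### Proof of `FreeFieldTwoPointFn` -/

/-- A normalised bump function as a real Schwartz function with the prescribed values.
[folklore] -/
theorem exists_realSchwartz_bump {E : Type*} [NormedAddCommGroup E] [InnerProductSpace ℝ E]
    [FiniteDimensional ℝ E] [MeasurableSpace E] [BorelSpace E] {c : E} (b : ContDiffBump c) :
    ∃ f : 𝓢(E, ℝ), ∀ v, f v = b.normed volume v :=
  ⟨b.hasCompactSupport_normed.toSchwartzMap b.contDiff_normed, fun _ => rfl⟩

-- heartbeats: the support/tensor bookkeeping of this proof repeatedly unifies large Schwartz-map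
-- coercions on `(ℝ^{d+1})²`; twice the default budget suffices (no single step diverges).
set_option maxHeartbeats 400000 in
/-- **Pointwise Euclidean identification**: under the Wick-rotation hypotheses of
`IsFreeHermitianScalarField`, the holomorphic two-point function of `W` agrees with the explicit
free one at every time-ordered Euclidean point. [cite: GlimmJaffeQP1987, §6.2 (6.2.9)] -/
theorem wick_eq_freeTwoPointWightmanHol_euclideanPoint {m : ℝ} (hm : 0 < m)
    {μ : Measure (FieldConfig (EuclideanSpace ℝ (Fin (d + 1))))}
    {S : SchwingerFamily (EuclideanSpace ℝ (Fin (d + 1)))}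
    (hfree : IsFreeField m μ) (hmom : HasAllMoments μ) (hS : IsSchwingerFamilyOf μ S)
    {𝔚 : (Fin 2 → Fin (d + 1) → ℂ) → ℂ} (hdiff : DifferentiableOn ℂ 𝔚 (forwardTube d 2))
    (heucl : ∀ F : 𝓢((Fin 2 → EuclideanSpace ℝ (Fin (d + 1))), ℂ), IsTimeOrdered F →
      S 2 F = ∫ x, 𝔚 (euclideanPoint x) * F x)
    {y : Fin 2 → EuclideanSpace ℝ (Fin (d + 1))} (hy : y ∈ QuantumFieldTheory.timeOrderedRegion d 2) :
    𝔚 (euclideanPoint y) = freeTwoPointWightmanHol d m (euclideanPoint y) := by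
  have hm0 : m ≠ 0 := hm.ne'
  have hU : IsOpen (QuantumFieldTheory.timeOrderedRegion d 2) :=
    QuantumFieldTheory.isOpen_timeOrderedRegion
  -- continuity of both functions along the Euclidean points of the time-ordered region
  have hcont1 : ContinuousOn (fun x => 𝔚 (euclideanPoint x)) (QuantumFieldTheory.timeOrderedRegion d 2) :=
    hdiff.continuousOn.comp QuantumFieldTheory.continuous_euclideanPoint.continuousOn
      QuantumFieldTheory.mapsTo_euclideanPoint_timeOrderedRegion
  have hcont2 : ContinuousOn (fun x => freeTwoPointWightmanHol d m (euclideanPoint x))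
      (QuantumFieldTheory.timeOrderedRegion d 2) :=
    (differentiableOn_freeTwoPointWightmanHol_forwardTube hm0).continuousOn.comp
      QuantumFieldTheory.continuous_euclideanPoint.continuousOn
      QuantumFieldTheory.mapsTo_euclideanPoint_timeOrderedRegion
  have hDc : ContinuousOn (fun x : Fin 2 → EuclideanSpace ℝ (Fin (d + 1)) =>
      𝔚 (euclideanPoint x) - freeTwoPointWightmanHol d m (euclideanPoint x))
      (QuantumFieldTheory.timeOrderedRegion d 2) := hcont1.sub hcont2
  -- the geometry of `y`: `0 < y₀⁰ < y₁⁰`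
  obtain ⟨hypos, hymono⟩ := hy
  have hy0 : 0 < y 0 0 := hypos 0
  have hy01 : y 0 0 < y 1 0 := hymono (show (0 : Fin 2) < 1 from Fin.zero_lt_one)
  obtain ⟨r₀, hr₀⟩ : ∃ r₀ : ℝ, r₀ = min (y 0 0) ((y 1 0 - y 0 0) / 4) := ⟨_, rfl⟩
  have hr₀pos : 0 < r₀ := by rw [hr₀]; exact lt_min hy0 (by linarith)
  suffices hzero : (fun x : Fin 2 → EuclideanSpace ℝ (Fin (d + 1)) =>
      𝔚 (euclideanPoint x) - freeTwoPointWightmanHol d m (euclideanPoint x)) y = 0 by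
    simpa [sub_eq_zero] using hzero
  refine eq_zero_of_integral_bump_tensor hU hDc ⟨hypos, hymono⟩ hr₀pos fun b₀ b₁ hb₀ hb₁ => ?_
  -- the real bumps as Schwartz functions and their tensor
  obtain ⟨f, hf⟩ := exists_realSchwartz_bump b₀
  obtain ⟨g, hg⟩ := exists_realSchwartz_bump b₁
  obtain ⟨P, hP⟩ := exists_isTensorOf ![ofRealTest f, ofRealTest g]
  have hPapply : ∀ x : Fin 2 → EuclideanSpace ℝ (Fin (d + 1)),
      P x = (b₀.normed volume (x 0) : ℂ) * (b₁.normed volume (x 1) : ℂ) := by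
    intro x
    rw [hP x, Fin.prod_univ_two]
    simp [ofRealTest_apply, hf, hg]
  have hPapply' : ∀ x : Fin 2 → EuclideanSpace ℝ (Fin (d + 1)),
      P x = ofRealTest f (x 0) * ofRealTest g (x 1) := by
    intro x
    rw [hP x, Fin.prod_univ_two]
    rfl
  have hfe : ((ofRealTest f : 𝓢(EuclideanSpace ℝ (Fin (d + 1)), ℂ)) :
      EuclideanSpace ℝ (Fin (d + 1)) → ℂ) = fun v => (b₀.normed volume v : ℂ) :=
    funext fun v => by simp [ofRealTest_apply, hf]
  have hge : ((ofRealTest g : 𝓢(EuclideanSpace ℝ (Fin (d + 1)), ℂ)) :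
      EuclideanSpace ℝ (Fin (d + 1)) → ℂ) = fun v => (b₁.normed volume v : ℂ) :=
    funext fun v => by simp [ofRealTest_apply, hg]
  -- supports
  have hr₀le0 : r₀ ≤ y 0 0 := by rw [hr₀]; exact min_le_left _ _
  have hr₀le1 : r₀ ≤ (y 1 0 - y 0 0) / 4 := by rw [hr₀]; exact min_le_right _ _
  have hsf : tsupport (ofRealTest f : EuclideanSpace ℝ (Fin (d + 1)) → ℂ) ⊆
      {v | v 0 < y 0 0 + r₀ ∧ y 0 0 - r₀ < v 0} := by
    intro v hv
    rw [hfe] at hv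
    have hv' := tsupport_comp_subset (g := ((↑) : ℝ → ℂ)) Complex.ofReal_zero (b₀.normed volume) hv
    rw [b₀.tsupport_normed_eq, Metric.mem_closedBall, dist_eq_norm] at hv'
    have h1 := abs_apply_le_norm (v - y 0) 0
    rw [PiLp.sub_apply, abs_le] at h1
    constructor <;> linarith
  have hsg : tsupport (ofRealTest g : EuclideanSpace ℝ (Fin (d + 1)) → ℂ) ⊆
      {v | v 0 < y 1 0 + r₀ ∧ y 1 0 - r₀ < v 0} := by
    intro v hv
    rw [hge] at hv
    have hv' := tsupport_comp_subset (g := ((↑) : ℝ → ℂ)) Complex.ofReal_zero (b₁.normed volume) hv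
    rw [b₁.tsupport_normed_eq, Metric.mem_closedBall, dist_eq_norm, hb₁] at hv'
    have h1 := abs_apply_le_norm (v - y 1) 0
    rw [PiLp.sub_apply, abs_le] at h1
    constructor <;> linarith
  -- the support of the tensor
  have hPsupp : tsupport (P : (Fin 2 → EuclideanSpace ℝ (Fin (d + 1))) → ℂ) ⊆
      {x | x 0 ∈ tsupport (ofRealTest f : EuclideanSpace ℝ (Fin (d + 1)) → ℂ) ∧
        x 1 ∈ tsupport (ofRealTest g : EuclideanSpace ℝ (Fin (d + 1)) → ℂ)} := by
    refine closure_minimal (fun x hx => ?_) ?_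
    · rw [Function.mem_support, hPapply'] at hx
      exact ⟨subset_tsupport _ (Function.mem_support.2 (left_ne_zero_of_mul hx)),
        subset_tsupport _ (Function.mem_support.2 (right_ne_zero_of_mul hx))⟩
    · exact ((isClosed_tsupport _).preimage (continuous_apply 0)).inter
        ((isClosed_tsupport _).preimage (continuous_apply 1))
  have hPcpt : HasCompactSupport (P : (Fin 2 → EuclideanSpace ℝ (Fin (d + 1))) → ℂ) := by
    have hKf : IsCompact (tsupport (ofRealTest f : EuclideanSpace ℝ (Fin (d + 1)) → ℂ)) := by
      rw [hfe]; exact b₀.hasCompactSupport_normed.comp_left Complex.ofReal_zero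
    have hKg : IsCompact (tsupport (ofRealTest g : EuclideanSpace ℝ (Fin (d + 1)) → ℂ)) := by
      rw [hge]; exact b₁.hasCompactSupport_normed.comp_left Complex.ofReal_zero
    refine IsCompact.of_isClosed_subset (isCompact_univ_pi (fun i =>
      (show ∀ i : Fin 2, IsCompact ((![tsupport (ofRealTest f : EuclideanSpace ℝ (Fin (d + 1)) → ℂ),
        tsupport (ofRealTest g : EuclideanSpace ℝ (Fin (d + 1)) → ℂ)] : Fin 2 → Set _) i) from
        fun i => by fin_cases i <;> assumption) i)) (isClosed_tsupport _) ?_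
    intro x hx
    obtain ⟨h0, h1⟩ := hPsupp hx
    rw [Set.mem_univ_pi]
    intro i
    fin_cases i
    · exact h0
    · exact h1
  -- `P` is time-ordered (supports in `{0 < x₀⁰ < x₁⁰}`)
  have hPto : IsTimeOrdered P := by
    intro x hx
    obtain ⟨h0, h1⟩ := hPsupp hx
    have a := hsf h0
    have b := hsg h1
    simp only [Set.mem_setOf_eq] at a b
    have hx0 : 0 < x 0 0 := by linarith [a.2]
    have hx01 : x 0 0 < x 1 0 := by linarith [a.1, b.2]
    refine ⟨fun i => ?_, ?_⟩
    · fin_cases i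
      · exact hx0
      · exact lt_trans hx0 hx01
    · rw [Fin.strictMono_iff_lt_succ]
      intro i
      fin_cases i
      exact hx01
  -- the two Euclidean integrals
  have hPU : tsupport (P : (Fin 2 → EuclideanSpace ℝ (Fin (d + 1))) → ℂ) ⊆
      QuantumFieldTheory.timeOrderedRegion d 2 := QuantumFieldTheory.isTimeOrdered_iff.1 hPto
  -- integrability of the two Euclidean integrands (domination by `M ‖P‖`, `P` a product of bumps)
  have hPint : Integrable (fun x : Fin 2 → EuclideanSpace ℝ (Fin (d + 1)) => P x) := by
    have h := Integrable.fintype_prod (ι := Fin 2) (μ := fun _ => volume)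
      (f := fun i => ((![fun v => (b₀.normed volume v : ℂ), fun v => (b₁.normed volume v : ℂ)] :
        Fin 2 → EuclideanSpace ℝ (Fin (d + 1)) → ℂ)) i) fun i => by
        fin_cases i
        · exact (Complex.continuous_ofReal.comp b₀.continuous_normed).integrable_of_hasCompactSupport
            (b₀.hasCompactSupport_normed.comp_left Complex.ofReal_zero)
        · exact (Complex.continuous_ofReal.comp b₁.continuous_normed).integrable_of_hasCompactSupport
            (b₁.hasCompactSupport_normed.comp_left Complex.ofReal_zero)
    refine h.congr (ae_of_all _ fun x => ?_)
    simp only [Fin.prod_univ_two, Matrix.cons_val_zero, Matrix.cons_val_one, hPapply x]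
  have hdom : ∀ {gg : (Fin 2 → Fin (d + 1) → ℂ) → ℂ},
      ContinuousOn (fun x => gg (euclideanPoint x)) (QuantumFieldTheory.timeOrderedRegion d 2) →
      Integrable (fun x : Fin 2 → EuclideanSpace ℝ (Fin (d + 1)) => gg (euclideanPoint x) * P x) := by
    intro gg hgg
    obtain ⟨M, hM⟩ := hPcpt.exists_bound_of_continuousOn (hgg.mono hPU)
    have hc : Continuous fun x : Fin 2 → EuclideanSpace ℝ (Fin (d + 1)) => gg (euclideanPoint x) * P x :=
      QuantumFieldTheory.continuous_mul_of_tsupport_subset hU hgg P.continuous hPU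
    refine (hPint.norm.const_mul (max M 0)).mono' hc.aestronglyMeasurable (ae_of_all _ fun x => ?_)
    by_cases hx : x ∈ tsupport (P : (Fin 2 → EuclideanSpace ℝ (Fin (d + 1))) → ℂ)
    · rw [norm_mul]
      exact mul_le_mul_of_nonneg_right ((hM x hx).trans (le_max_left _ _)) (norm_nonneg _)
    · rw [image_eq_zero_of_notMem_tsupport hx, mul_zero, norm_zero, mul_zero]
  have hI1 : Integrable (fun x : Fin 2 → EuclideanSpace ℝ (Fin (d + 1)) => 𝔚 (euclideanPoint x) * P x) :=
    hdom hcont1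
  have hI2 : Integrable (fun x : Fin 2 → EuclideanSpace ℝ (Fin (d + 1)) =>
      freeTwoPointWightmanHol d m (euclideanPoint x) * P x) := hdom hcont2
  have hS2 : ∫ x, 𝔚 (euclideanPoint x) * P x = freeCovariance m (ofRealTest f) (ofRealTest g) := by
    rw [← heucl P hPto]
    have hfam : (fun i => ofRealTest ((![f, g] : Fin 2 → 𝓢(EuclideanSpace ℝ (Fin (d + 1)), ℝ)) i)) =
        ![ofRealTest f, ofRealTest g] := by
      funext i
      fin_cases i <;> rfl
    rw [hS 2 ![f, g] P (by rw [hfam]; exact hP), IsFreeField.moment_two hm0 hfree hmom f g]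
    refine Complex.ext (by simp [freeCovarianceReal]) ?_
    rw [Complex.ofReal_im, freeCovariance_ofRealTest_im]
  have hFree : ∫ x, freeTwoPointWightmanHol d m (euclideanPoint x) * P x =
      freeCovariance m (ofRealTest f) (ofRealTest g) := by
    simp_rw [hPapply']
    exact integral_freeTwoPointWightmanHol_euclideanPoint_eq hm0 (c₁ := y 0 0 + r₀)
      (c₂ := y 1 0 - r₀) (by linarith) (fun v hv => (hsf hv).1) (fun v hv => (hsg hv).2)
      (fun v => by simp [ofRealTest_apply])
  -- conclusion
  calc ∫ x, (fun x : Fin 2 → EuclideanSpace ℝ (Fin (d + 1)) =>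
        𝔚 (euclideanPoint x) - freeTwoPointWightmanHol d m (euclideanPoint x)) x *
          ((b₀.normed volume (x 0) : ℂ) * (b₁.normed volume (x 1) : ℂ))
      = ∫ x, (𝔚 (euclideanPoint x) * P x - freeTwoPointWightmanHol d m (euclideanPoint x) * P x) := by
        refine integral_congr_ae (Eventually.of_forall fun x => ?_)
        simp only [hPapply]
        ring
    _ = 0 := by
        rw [integral_sub hI1 hI2, hS2, hFree, sub_self]

/-- **`FreeFieldTwoPointFn` holds**: the two-point Wightman function of a free hermitian scalar
field of mass `m > 0` in the tree's (Euclidean) sense is `freeTwoPoint d m` (Glimm–Jaffe §6.2,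
"Then `W₂ = Δ⁺ₘ`"; Streater–Wightman §3-2). [cite: GlimmJaffeQP1987, §6.2 (6.2.6)-(6.2.10), Thm 6.2.4 and Definition] -/
theorem FreeFieldTwoPointFn_holds : FreeFieldTwoPointFn := by
  intro d m hm W hW F G
  obtain ⟨-, μ, S, hfree, hmom, hS, hwick⟩ := hW
  obtain ⟨𝔚, hdiff, ⟨T, hT, hbv⟩, heucl⟩ := hwick 2
  have hm0 : m ≠ 0 := hm.ne'
  -- Euclidean identification, pointwise, then on the whole forward tube
  have hpt : ∀ y ∈ QuantumFieldTheory.timeOrderedRegion d 2,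
      𝔚 (euclideanPoint y) = freeTwoPointWightmanHol d m (euclideanPoint y) := fun y hy =>
    wick_eq_freeTwoPointWightmanHol_euclideanPoint hm hfree hmom hS hdiff heucl hy
  have hEqOn : Set.EqOn 𝔚 (freeTwoPointWightmanHol d m) (forwardTube d 2) :=
    QuantumFieldTheory.eqOn_forwardTube_of_euclidean hdiff
      (differentiableOn_freeTwoPointWightmanHol_forwardTube hm0) hpt
  -- boundary values on the tensor `F ⊗ G`
  obtain ⟨P, hP⟩ := exists_isTensorOf ![F, G]
  have hPapply : ∀ x : Fin 2 → SpaceTime d, P x = F (x 0) * G (x 1) := by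
    intro x
    rw [hP x, Fin.prod_univ_two]
    rfl
  set η₀ : Fin 2 → SpaceTime d := fun k => (((k : ℕ) : ℝ) + 1) • e₀ d with hη₀
  have hη₀' : η₀ ∈ tubeCone d 2 := QuantumFieldTheory.stdDirection_mem_tubeCone
  have h1 : Tendsto (fun t : ℝ => ∫ x : Fin 2 → SpaceTime d,
      𝔚 (fun k => complexifyPoint (x k) + ((t : ℂ) * I) • complexifyPoint (η₀ k)) * P x)
      (𝓝[>] 0) (𝓝 (T P)) := hbv η₀ hη₀' P
  have h2 := tendsto_integral_freeTwoPointWightmanHol_tensor hm0 F G hη₀'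
  have hcongr : (fun t : ℝ => ∫ x : Fin 2 → SpaceTime d,
      𝔚 (fun k => complexifyPoint (x k) + ((t : ℂ) * I) • complexifyPoint (η₀ k)) * P x)
      =ᶠ[𝓝[>] 0] fun t : ℝ => ∫ x : Fin 2 → SpaceTime d,
        freeTwoPointWightmanHol d m
            (fun k => complexifyPoint (x k) + ((t : ℂ) * I) • complexifyPoint (η₀ k)) *
          (F (x 0) * G (x 1)) := by
    filter_upwards [self_mem_nhdsWithin] with t ht
    refine integral_congr_ae (Eventually.of_forall fun x => ?_)
    simp only
    rw [hEqOn (mem_forwardTube_of_mem_tubeCone x η₀ hη₀' ht), hPapply]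
  have h1' := h1.congr' hcongr
  rw [← hT _ P hP]
  exact tendsto_nhds_unique h1' h2

end Literature.Barriers.QuantumFields
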